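import Mathlib
import HarnessLib.Audit
import Summits.AnomalousDissipation.AnomalousDissipation.Theses.DyadicWallCascade
import Summits.AnomalousDissipation.AnomalousDissipation.Theorems.DyadicWallCascadeHalfSpaceHierarchySlabOfBand
import Summits.AnomalousDissipation.AnomalousDissipation.Theorems.DyadicWallCascadeHalfSpaceHierarchySlabExtension
import Summits.AnomalousDissipation.AnomalousDissipation.Theorems.DyadicWallCascadeHalfSpaceHierarchyFluxHeightInvariance
import Summits.AnomalousDissipation.AnomalousDissipation.Theorems.DyadicWallCascadeHalfSpaceHierarchyHalfScaleTrace
import Summits.AnomalousDissipation.AnomalousDissipation.Theorems.DyadicWallCascadeHalfSpaceHierarchyCellToBand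

/-!
# Line `bernoulli-surface-topology` — skeleton for the crux `DyadicWallCascade.HalfSpaceHierarchy`
# (item stmt-AnomalousDissipation-18627; crux-plan of idea `Ideas/bernoulli-surface-topology.md` + TRIAGE r1-1/2/3)

THE IDEA AND WHAT TRIAGE MADE OF IT.  The card's lever is a BUDGET: on every regular Bernoulli leaf `{B = b}`
(`B = ‖V‖²/2 + Q`) the commuting frame `(V, ω)` plus Poincaré–Hopf plus Sard plus the `×4` flux bookkeeping of the
dilation `X ↦ 2X` says which leaf topologies a witness can have.  The panel (TRIAGE-r1-1 Lemma K = r1-2 App. A =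
r1-3 App. A) verified the lever and showed it is STRONGER than the card said: it empties every architecture whose
flux-carrying conduits contain an exactly axis-independent (columnar) stretch ("NoBifurcatingPipe": parity of cut
circles + the weight equation `g(x) = 4 g(4x) ⇒ g ≡ 0`), including the card's own "tilted swirl leg" normal form and
its Transfer `C⁺ = crux ∧ normal form` (costume).  What the budget leaves standing (r1-3 App. B2–B3, r1-1 "winding-1
helical counterflow", dossier (L7)–(L10)) is ONE architecture: conduits whose core-wall flow has WINDING 1 (up- and
down-going wall jets spiralling around a potential through-core: helically symmetric on the stretches between
junctions, net flux on the core plateau, counter-wound vortical collar, `C^∞`-flat outer edge into fluid at rest)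
joined by SYMMETRY-BREAKING `1 → 4` junctions, one per cell and octave; and ONE why-easier SHAPE (r1-3 B3, r1-2
`LocalPipeJunction` sharpen): junction pieces sitting in exact conduit stretches DECOUPLE — the self-similar closure
(strategist census T1(iii): a Livšic/cohomological equation over `x ↦ 2x`, the step on which line `Sketch` died with
`stub_bandProfile ≡ crux`) disappears, because the matching data on the two collars of the fundamental cell are no
longer the unknown's own rescaled jet but the jet of an EXACT entire solution `G` (top collar) and of `G(2·)` (bottom
collar).  This file types exactly that shape.

THE SKELETON (four registered stubs after the lead's reshape v1; three LANDED in wave 1 — `stub_fluxHeightInvariance`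
p162671, `stub_halfScaleTrace` p162336, `stub_cellToBand` p162507 — and re-exported here by name; the only `sorry`
left is `stub_cellJunction`; composition through two LANDED theorems of line `Sketch`):

* `stub_cellJunction` (∃; the bet; XL / open, Grad-class) — there are an entire smooth `ℤ²`-periodic steady Euler
  "conduit array" `(G, P_G)` on `ℝ³` with zero mass flux and non-zero energy flux `F` per unit cell, and a smooth
  steady Euler pair `(U, P)` on a neighbourhood `{1-η < z < 2+η}` of the fundamental band, `ℤ²`-periodic on the band,
  which COINCIDES with `(G, P_G)` on the top collar `{|z-2| < η}` and with `(G, P_G)(2·)` (four half-scale copies per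
  cell) on the bottom collar `{|z-1| < η}`.  No dilation clause, no self-reference: a steady-Euler CONNECTION problem
  between two explicit exact states across one compact cell.
* `stub_fluxHeightInvariance` + `stub_halfScaleTrace` (M + S/M; classical; RESHAPE by lead a1 of the planner's
  single `stub_conduitFlux`, same composition idea) — for such `(G, P_G)` the mass flux and the energy flux through
  the unit period square do not depend on the height (divergence theorem on `[0,1]²×[a,b]` with periodic lateral
  faces; `div(B G) = 0` for steady Euler), and for any continuous doubly `1`-periodic scalar `g` the bottom-trace
  integral `∫_{[0,1]²} g(2q₁, 2q₂, 2) dq` equals `∫_{[0,1]²} g(q, 2) dq` (linear change of variables `q ↦ 2q`, cf.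
  landed `stub_fluxQuadruplesPerOctave`, + periodic 4-cell decomposition of `[0,2]²`).
* `stub_cellToBand` (M/L; pure gluing) — a cell solution with exact collars IS a band profile (verbatim the
  antecedent of the landed `Theorems.HalfSpaceHierarchy.stub_slabOfBand`, p149183): put `Ṽ := U(2·)` on `1/2 < z < 1`,
  `Ṽ := U` on `1 ≤ z ≤ 2`, `Ṽ := U(·/2)` on `2 < z < 4`; near `z = 1` all pieces equal `G(2·)`, near `z = 2` all equal
  `G`, so `Ṽ` is `C^∞` on the open slab, `Ṽ(2X) = Ṽ X` for `1/2 < z < 2` holds by construction, `Ṽ = U` on an open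
  neighbourhood of the closed band (Euler, divergence, periodicity transfer) and `Ṽ(q,1) = G(2q, 2)` turns the flux
  clauses into the consumed-form integrals supplied by `stub_fluxHeightInvariance` + `stub_halfScaleTrace`.
* `HalfSpaceHierarchy_of` — sorry-free: `stub_slabExtension (stub_slabOfBand (stub_cellToBand … ))` with the two
  consumed-form flux clauses obtained from `stub_fluxHeightInvariance` (heights `0`, `2`) and `stub_halfScaleTrace`,
  applied to the witnesses of `stub_cellJunction` (both outer theorems LANDED: p146691, p149183; cited by name).

HARDEST STUB: `stub_cellJunction`.  It is NOT the crux reworded: the crux (≡ `stub_bandProfile`, both directions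
landed) asks for a band field whose bottom ∞-jet equals its own rescaled top ∞-jet; the stub asks for a band field
whose two collars are prescribed pieces of an entire exact solution — every solution of the stub solves the crux (via
the two glue stubs), the converse is not known (a witness's germ along `{z = 2}` need not extend to an entire periodic
steady flow), and none of census T1(iii) (Livšic closure) survives in it; T1(i) (no integrable base flow) and T1(ii)
(no transverse section: the collars carry counterflow) DO survive — this is where the line can die.

DESIGN LAWS THE ∃-WITNESS MUST OBEY (the budget = this card's lever, as sharpened by the panel; informal, binding):
(1) no flux-carrying conduit of `G` may be axis-independent on the collars (NoBifurcatingPipe, App. A; the landed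
`Negative/Columnar` p146880 is its global special case) — the intended `G` is a pair of HELICALLY symmetric conduit
arrays (descending cores of head `b_D`, ascending cores of head `b_A ≠ b_D`, `F = m (b_A - b_D)` up to the cubic
collar terms) with supports in disjoint vertical cylinders and fluid at rest between them; (2) App. A EXTENDS to
helically symmetric ends (new remark of this seat, `Lines/bernoulli-surface-topology.md` §Budget-extension): on a
helically invariant regular leaf `Σ ≅ S¹ × ℝ` one has `V = a(σ)∂_σ + b(σ)ξ` with `μ a ≡ const` (invariant Gelfand–Leray
area form), hence either `a ≡ 0` (one-signed `V₃`, horizontal cuts transverse), or all orbits closed (invariant cut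
loops), or slanted closed transversals `t = f(σ)`, `f' = (b - c)/a` exist — so every collar leaf whose admissible loop
FITS inside the symmetric stretch carries zero net transit per head (weight equation), and the net flux rides on the
potential core plateau; the winding-1 NEAR-WALL leaves escape only because `a → 0` at two wall points makes their
admissible loops arbitrarily tall ("wall-to-wall excursions", dossier (L10)) — the design must keep the flux-relevant
collar in that tall-excursion regime and must break the vertical mirrors; (3) the seven landed `Negative/` lemmas
(ConstantHead, Reversible, Analytic, Columnar, OneSigned, Pressureless, XIndependent) are met by the architecture by
inspection (two heads; no reversing isometry; `U` flat-glued hence non-analytic; `z`-dependent junctions; counterflow;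
`∇P ≠ 0` in collars; both horizontal variables active); (4) Disproof §E.4: zero angular-momentum flux and zero
helicity flux per conduit tree, virial-balanced junction cores — scalar constraints a counter-wound collar can meet.

Namespace `…Cruxes.HalfSpaceHierarchy.BernoulliSurfaceTopology`; registered stub signatures contain no `let` and no
comments (the registry cuts at the first `:=`).
-/

set_option linter.dupNamespace false
set_option linter.unusedVariables false

noncomputable section

open scoped BigOperators Topology InnerProductSpace
open MeasureTheory
open Summit.AnomalousDissipation.AnomalousDissipation.Theses.DyadicWallCascade

namespace Summit.AnomalousDissipation.AnomalousDissipation.Cruxes.HalfSpaceHierarchy.BernoulliSurfaceTopology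

/-! ## §1 The bet: a steady-Euler connection across one cell between an exact conduit array and its four-fold half-scale copy -/

/-- **Stub (the bet, XL / open).**  `stub_cellJunction`: there exist
* a CONDUIT ARRAY `(G, PG)`: `C^∞` on all of `ℝ³`, divergence free, steady Euler `(DG)G + ∇PG = 0` everywhere,
  `1`-periodic in `x` and in `y`, with zero mass flux and energy flux `F ≠ 0` through the unit cell cross-section
  `[0,1]² × {0}` (intended: two helically symmetric conduit families in fluid at rest — descending potential cores of
  one head, ascending cores of another, counter-wound vortical collars with winding-1 core-wall pattern, `C^∞`-flat
  outer edges, supports in disjoint vertical cylinders; columnar conduits are excluded on paper by the budget);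
* a CELL SOLUTION `(U, P)` and a collar width `0 < η < 1/2`: `C^∞` on the open slab `{1-η < z < 2+η}`, divergence free
  and steady Euler on the open band `{1 < z < 2}`, `1`-periodic in `x, y` on the closed band, EQUAL to `(G, PG)` on the
  top collar `{2-η < z < 2+η}` and to `(G, PG) ∘ (2•)` on the bottom collar `{1-η < z < 1+η}`.
The junction content: inside the cell the parent conduits (trace of `G` near `z = 2`) must be connected smoothly and
steadily to their four translated half-scale copies (trace of `G(2·)` near `z = 1`) — one symmetry-breaking `1 → 4`
split per conduit and cell (r1-3 App. B3 `LocalHelicalJunction`, r1-2 `LocalPipeJunction` with helical instead of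
columnar ends).  Grad-class (census §0.4, R1); no engine known; NOT the crux reworded (see the module docstring). -/
theorem stub_cellJunction :
    ∃ (G : EuclideanSpace ℝ (Fin 3) → EuclideanSpace ℝ (Fin 3)) (PG : EuclideanSpace ℝ (Fin 3) → ℝ)
      (U : EuclideanSpace ℝ (Fin 3) → EuclideanSpace ℝ (Fin 3)) (P : EuclideanSpace ℝ (Fin 3) → ℝ) (F η : ℝ),
      ContDiff ℝ ((⊤ : ℕ∞) : WithTop ℕ∞) G ∧ ContDiff ℝ ((⊤ : ℕ∞) : WithTop ℕ∞) PG ∧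
      (∀ X : EuclideanSpace ℝ (Fin 3), ∑ i : Fin 3, (fderiv ℝ G X (EuclideanSpace.single i (1 : ℝ))) i = 0) ∧
      (∀ X : EuclideanSpace ℝ (Fin 3), (fderiv ℝ G X) (G X) + gradient PG X = 0) ∧
      (∀ X : EuclideanSpace ℝ (Fin 3),
        G (X + EuclideanSpace.single 0 (1 : ℝ)) = G X ∧ G (X + EuclideanSpace.single 1 (1 : ℝ)) = G X ∧
        PG (X + EuclideanSpace.single 0 (1 : ℝ)) = PG X ∧ PG (X + EuclideanSpace.single 1 (1 : ℝ)) = PG X) ∧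
      (∫ q in Set.Icc (0 : ℝ) 1 ×ˢ Set.Icc (0 : ℝ) 1, (G !₂[q.1, q.2, (0 : ℝ)]) 2 = 0) ∧ F ≠ 0 ∧
      (∫ q in Set.Icc (0 : ℝ) 1 ×ˢ Set.Icc (0 : ℝ) 1,
        (G !₂[q.1, q.2, (0 : ℝ)]) 2 * (‖G !₂[q.1, q.2, (0 : ℝ)]‖ ^ 2 / 2 + PG !₂[q.1, q.2, (0 : ℝ)]) = F) ∧
      0 < η ∧ η < 1 / 2 ∧
      ContDiffOn ℝ ((⊤ : ℕ∞) : WithTop ℕ∞) U {Y : EuclideanSpace ℝ (Fin 3) | 1 - η < Y 2 ∧ Y 2 < 2 + η} ∧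
      ContDiffOn ℝ ((⊤ : ℕ∞) : WithTop ℕ∞) P {Y : EuclideanSpace ℝ (Fin 3) | 1 - η < Y 2 ∧ Y 2 < 2 + η} ∧
      (∀ X : EuclideanSpace ℝ (Fin 3), 1 < X 2 → X 2 < 2 →
        ∑ i : Fin 3, (fderiv ℝ U X (EuclideanSpace.single i (1 : ℝ))) i = 0) ∧
      (∀ X : EuclideanSpace ℝ (Fin 3), 1 < X 2 → X 2 < 2 → (fderiv ℝ U X) (U X) + gradient P X = 0) ∧
      (∀ X : EuclideanSpace ℝ (Fin 3), 1 ≤ X 2 → X 2 ≤ 2 →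
        U (X + EuclideanSpace.single 0 (1 : ℝ)) = U X ∧ U (X + EuclideanSpace.single 1 (1 : ℝ)) = U X ∧
        P (X + EuclideanSpace.single 0 (1 : ℝ)) = P X ∧ P (X + EuclideanSpace.single 1 (1 : ℝ)) = P X) ∧
      (∀ X : EuclideanSpace ℝ (Fin 3), 2 - η < X 2 → X 2 < 2 + η → U X = G X ∧ P X = PG X) ∧
      (∀ X : EuclideanSpace ℝ (Fin 3), 1 - η < X 2 → X 2 < 1 + η →
        U X = G ((2 : ℝ) • X) ∧ P X = PG ((2 : ℝ) • X)) := by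
  sorry

/-! ## §2 Flux bookkeeping of the conduit array (classical; reshaped by lead a1 into two stubs) -/

/-- **Stub (M, classical).**  `stub_fluxHeightInvariance`: for an entire smooth divergence-free steady Euler pair
`(G, PG)`, `1`-periodic in `x` and `y`, the mass flux `∫_{[0,1]²} G₃(q, z) dq` and the energy flux
`∫_{[0,1]²} G₃ (‖G‖²/2 + PG)(q, z) dq` through the unit period square do not depend on the height `z`: divergence
theorem (`MeasureTheory.integral_divergence_of_hasFDerivAt_off_countable` transported to `EuclideanSpace ℝ (Fin 3)`
through `EuclideanSpace.equiv`/`PiLp.continuousLinearEquiv`, faces `Fin 2 → ℝ` identified with `ℝ × ℝ` by the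
measure-preserving `MeasurableEquiv.finTwoArrow`) on the box `[0,1]² × [a, b]`; the two pairs of lateral faces cancel
by periodicity; the divergence of `G` is `0` by hypothesis and the divergence of the energy current `(‖G‖²/2 + PG) G`
is `G · ((DG) G + ∇PG) + (‖G‖²/2 + PG) div G = 0` (steady Bernoulli identity). [folklore] -/
theorem stub_fluxHeightInvariance :
    ∀ (G : EuclideanSpace ℝ (Fin 3) → EuclideanSpace ℝ (Fin 3)) (PG : EuclideanSpace ℝ (Fin 3) → ℝ),
      ContDiff ℝ ((⊤ : ℕ∞) : WithTop ℕ∞) G → ContDiff ℝ ((⊤ : ℕ∞) : WithTop ℕ∞) PG →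
      (∀ X : EuclideanSpace ℝ (Fin 3), ∑ i : Fin 3, (fderiv ℝ G X (EuclideanSpace.single i (1 : ℝ))) i = 0) →
      (∀ X : EuclideanSpace ℝ (Fin 3), (fderiv ℝ G X) (G X) + gradient PG X = 0) →
      (∀ X : EuclideanSpace ℝ (Fin 3),
        G (X + EuclideanSpace.single 0 (1 : ℝ)) = G X ∧ G (X + EuclideanSpace.single 1 (1 : ℝ)) = G X ∧
        PG (X + EuclideanSpace.single 0 (1 : ℝ)) = PG X ∧ PG (X + EuclideanSpace.single 1 (1 : ℝ)) = PG X) →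
      ∀ a b : ℝ,
        (∫ q in Set.Icc (0 : ℝ) 1 ×ˢ Set.Icc (0 : ℝ) 1, (G !₂[q.1, q.2, b]) 2 =
          ∫ q in Set.Icc (0 : ℝ) 1 ×ˢ Set.Icc (0 : ℝ) 1, (G !₂[q.1, q.2, a]) 2) ∧
        (∫ q in Set.Icc (0 : ℝ) 1 ×ˢ Set.Icc (0 : ℝ) 1,
            (G !₂[q.1, q.2, b]) 2 * (‖G !₂[q.1, q.2, b]‖ ^ 2 / 2 + PG !₂[q.1, q.2, b]) =
          ∫ q in Set.Icc (0 : ℝ) 1 ×ˢ Set.Icc (0 : ℝ) 1,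
            (G !₂[q.1, q.2, a]) 2 * (‖G !₂[q.1, q.2, a]‖ ^ 2 / 2 + PG !₂[q.1, q.2, a])) :=
  Summit.AnomalousDissipation.AnomalousDissipation.Theorems.HalfSpaceHierarchy.stub_fluxHeightInvariance

/-- **Stub (S/M, classical).**  `stub_halfScaleTrace`: for a continuous scalar function `g` on `ℝ³`, `1`-periodic in
`x` and in `y`, the integral over the unit square of its half-scale bottom trace `q ↦ g (2 • (q₁, q₂, 1)) = g (2q₁, 2q₂, 2)`
equals its integral over the unit square at height `2`: linear change of variables `q ↦ 2q` in `ℝ × ℝ`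
(`Measure.setIntegral_comp_smul_of_pos`, cf. landed `setIntegral_dilatedSquare_comp_half_smul`, p146417) gives
`¼ ∫_{[0,2]²} g(·, 2)`, and `[0,2]²` consists of four period cells (iterated interval integrals of a continuous
integrand, `Function.Periodic.intervalIntegral_add_eq`). Applied in `HalfSpaceHierarchy_of` to `g = G₃` and to
`g = G₃ (‖G‖²/2 + PG)`. [folklore] -/
theorem stub_halfScaleTrace :
    ∀ (g : EuclideanSpace ℝ (Fin 3) → ℝ), Continuous g →
      (∀ X : EuclideanSpace ℝ (Fin 3),
        g (X + EuclideanSpace.single 0 (1 : ℝ)) = g X ∧ g (X + EuclideanSpace.single 1 (1 : ℝ)) = g X) →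
      (∫ q in Set.Icc (0 : ℝ) 1 ×ˢ Set.Icc (0 : ℝ) 1, g ((2 : ℝ) • !₂[q.1, q.2, (1 : ℝ)])) =
        ∫ q in Set.Icc (0 : ℝ) 1 ×ˢ Set.Icc (0 : ℝ) 1, g !₂[q.1, q.2, (2 : ℝ)] :=
  Summit.AnomalousDissipation.AnomalousDissipation.Theorems.HalfSpaceHierarchy.stub_halfScaleTrace

/-! ## §3 Gluing: a cell solution with exact collars is a band profile -/

/-- **Stub (M/L, pure gluing).**  `stub_cellToBand`: let `G, PG` be `C^∞` on `ℝ³`, `0 < η < 1/2`, and `(U, P)` a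
cell solution as in `stub_cellJunction` (smooth on `{1-η < z < 2+η}`, divergence free and steady Euler on the open
band, `1`-periodic on the closed band, `= (G, PG)` on the top collar, `= (G, PG)(2·)` on the bottom collar) whose
bottom-trace flux integrals are `0` and `F ≠ 0`.  Then the BAND PROFILE of line `Sketch` exists (verbatim the
antecedent of the landed `Theorems.HalfSpaceHierarchy.stub_slabOfBand`, p149183): define
`Ṽ X := U (2 • X)` if `X₂ < 1`, `U X` if `1 ≤ X₂ ≤ 2`, `U ((1/2) • X)` if `2 < X₂` (same for `Q̃` from `P`).  Then
`Ṽ = G (2·)` on `{1 - η/2 < z < 1 + η}` and `Ṽ = G` on `{2 - η < z < 2 + 2η}` (collar identities), `Ṽ = U (2·)`,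
`U`, `U (·/2)` on the three open pieces — smooth functions on an open cover of `{1/2 < z < 4}`, so `ContDiffOn ⊤`
there (`contDiffOn` is local); `Ṽ = U` on the open set `{1 - η/2 < z < 2 + η} ⊇` closed band, so `fderiv Ṽ = fderiv U`
on the open band (`Filter.EventuallyEq.fderiv_eq`) and divergence / Euler / periodicity transfer; `Ṽ (2X) = Ṽ X` for
`1/2 < X₂ < 2` by the case split (`X₂ < 1`: both sides are `U (2X)`; `1 ≤ X₂`: `Ṽ (2X) = U X`); and
`Ṽ (q₁, q₂, 1) = U (q₁, q₂, 1) = G (2 • (q₁, q₂, 1))` (bottom collar at height `1`) rewrites the two flux clauses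
into the hypotheses.  Only smoothness of `G` is used (not its equation: Euler on the slab off the band is recovered
from the dilation relation by the landed `stub_bandEulerTools` inside `stub_slabOfBand`). -/
theorem stub_cellToBand :
    ∀ (G : EuclideanSpace ℝ (Fin 3) → EuclideanSpace ℝ (Fin 3)) (PG : EuclideanSpace ℝ (Fin 3) → ℝ)
      (U : EuclideanSpace ℝ (Fin 3) → EuclideanSpace ℝ (Fin 3)) (P : EuclideanSpace ℝ (Fin 3) → ℝ) (F η : ℝ),
      ContDiff ℝ ((⊤ : ℕ∞) : WithTop ℕ∞) G → ContDiff ℝ ((⊤ : ℕ∞) : WithTop ℕ∞) PG →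
      0 < η → η < 1 / 2 →
      ContDiffOn ℝ ((⊤ : ℕ∞) : WithTop ℕ∞) U {Y : EuclideanSpace ℝ (Fin 3) | 1 - η < Y 2 ∧ Y 2 < 2 + η} →
      ContDiffOn ℝ ((⊤ : ℕ∞) : WithTop ℕ∞) P {Y : EuclideanSpace ℝ (Fin 3) | 1 - η < Y 2 ∧ Y 2 < 2 + η} →
      (∀ X : EuclideanSpace ℝ (Fin 3), 1 < X 2 → X 2 < 2 →
        ∑ i : Fin 3, (fderiv ℝ U X (EuclideanSpace.single i (1 : ℝ))) i = 0) →
      (∀ X : EuclideanSpace ℝ (Fin 3), 1 < X 2 → X 2 < 2 → (fderiv ℝ U X) (U X) + gradient P X = 0) →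
      (∀ X : EuclideanSpace ℝ (Fin 3), 1 ≤ X 2 → X 2 ≤ 2 →
        U (X + EuclideanSpace.single 0 (1 : ℝ)) = U X ∧ U (X + EuclideanSpace.single 1 (1 : ℝ)) = U X ∧
        P (X + EuclideanSpace.single 0 (1 : ℝ)) = P X ∧ P (X + EuclideanSpace.single 1 (1 : ℝ)) = P X) →
      (∀ X : EuclideanSpace ℝ (Fin 3), 2 - η < X 2 → X 2 < 2 + η → U X = G X ∧ P X = PG X) →
      (∀ X : EuclideanSpace ℝ (Fin 3), 1 - η < X 2 → X 2 < 1 + η →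
        U X = G ((2 : ℝ) • X) ∧ P X = PG ((2 : ℝ) • X)) →
      (∫ q in Set.Icc (0 : ℝ) 1 ×ˢ Set.Icc (0 : ℝ) 1, (G ((2 : ℝ) • !₂[q.1, q.2, (1 : ℝ)])) 2 = 0) →
      F ≠ 0 →
      (∫ q in Set.Icc (0 : ℝ) 1 ×ˢ Set.Icc (0 : ℝ) 1,
        (G ((2 : ℝ) • !₂[q.1, q.2, (1 : ℝ)])) 2 *
          (‖G ((2 : ℝ) • !₂[q.1, q.2, (1 : ℝ)])‖ ^ 2 / 2 + PG ((2 : ℝ) • !₂[q.1, q.2, (1 : ℝ)])) = F) →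
      ∃ (V : EuclideanSpace ℝ (Fin 3) → EuclideanSpace ℝ (Fin 3)) (Q : EuclideanSpace ℝ (Fin 3) → ℝ) (F : ℝ),
        ContDiffOn ℝ ((⊤ : ℕ∞) : WithTop ℕ∞) V {Y : EuclideanSpace ℝ (Fin 3) | 1 / 2 < Y 2 ∧ Y 2 < 4} ∧
        ContDiffOn ℝ ((⊤ : ℕ∞) : WithTop ℕ∞) Q {Y : EuclideanSpace ℝ (Fin 3) | 1 / 2 < Y 2 ∧ Y 2 < 4} ∧
        (∀ X : EuclideanSpace ℝ (Fin 3), 1 < X 2 → X 2 < 2 →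
          ∑ i : Fin 3, (fderiv ℝ V X (EuclideanSpace.single i (1 : ℝ))) i = 0) ∧
        (∀ X : EuclideanSpace ℝ (Fin 3), 1 < X 2 → X 2 < 2 → (fderiv ℝ V X) (V X) + gradient Q X = 0) ∧
        (∀ X : EuclideanSpace ℝ (Fin 3), 1 / 2 < X 2 → X 2 < 2 → V ((2 : ℝ) • X) = V X ∧ Q ((2 : ℝ) • X) = Q X) ∧
        (∀ X : EuclideanSpace ℝ (Fin 3), 1 ≤ X 2 → X 2 ≤ 2 →
          V (X + EuclideanSpace.single 0 (1 : ℝ)) = V X ∧ V (X + EuclideanSpace.single 1 (1 : ℝ)) = V X ∧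
          Q (X + EuclideanSpace.single 0 (1 : ℝ)) = Q X ∧ Q (X + EuclideanSpace.single 1 (1 : ℝ)) = Q X) ∧
        (∫ q in Set.Icc (0 : ℝ) 1 ×ˢ Set.Icc (0 : ℝ) 1, (V !₂[q.1, q.2, (1 : ℝ)]) 2 = 0) ∧ F ≠ 0 ∧
        (∫ q in Set.Icc (0 : ℝ) 1 ×ˢ Set.Icc (0 : ℝ) 1,
          (V !₂[q.1, q.2, (1 : ℝ)]) 2 * (‖V !₂[q.1, q.2, (1 : ℝ)]‖ ^ 2 / 2 + Q !₂[q.1, q.2, (1 : ℝ)]) = F) :=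
  Summit.AnomalousDissipation.AnomalousDissipation.Theorems.HalfSpaceHierarchy.stub_cellToBand

/-! ## §4 Composition (sorry-free): the stubs prove the crux `HalfSpaceHierarchy` BY NAME -/

/-- **Composition.**  The cell junction (`stub_cellJunction`) has the consumed-form fluxes (`stub_fluxHeightInvariance`
between heights `0` and `2`, then `stub_halfScaleTrace` for the two flux integrands), is a band profile
(`stub_cellToBand`), hence a slab profile (landed `stub_slabOfBand`, p149183), hence — extended along the dyadic scale
by `V(X) := V(2^{-k}X)` — a half-space hierarchy (landed `stub_slabExtension`, p146691). -/
theorem HalfSpaceHierarchy_of : HalfSpaceHierarchy := by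
  obtain ⟨G, PG, U, P, F, η, hG, hPG, hGdiv, hGE, hGper, hGm, hF, hGe, hη, hη', hU, hP, hUdiv, hUE, hUper,
    htop, hbot⟩ := stub_cellJunction
  obtain ⟨hmass, henergy⟩ := stub_fluxHeightInvariance G PG hG hPG hGdiv hGE hGper 0 2
  have hGc : Continuous G := hG.continuous
  have hPGc : Continuous PG := hPG.continuous
  have h3 : Continuous fun X : EuclideanSpace ℝ (Fin 3) => (G X) 2 :=
    (continuous_apply 2).comp ((PiLp.continuous_ofLp 2 _).comp hGc)
  have hB : Continuous fun X : EuclideanSpace ℝ (Fin 3) => (G X) 2 * (‖G X‖ ^ 2 / 2 + PG X) :=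
    h3.mul (((hGc.norm.pow 2).div_const 2).add hPGc)
  have hper3 : ∀ X : EuclideanSpace ℝ (Fin 3),
      (fun Y : EuclideanSpace ℝ (Fin 3) => (G Y) 2) (X + EuclideanSpace.single 0 (1 : ℝ)) =
        (fun Y : EuclideanSpace ℝ (Fin 3) => (G Y) 2) X ∧
      (fun Y : EuclideanSpace ℝ (Fin 3) => (G Y) 2) (X + EuclideanSpace.single 1 (1 : ℝ)) =
        (fun Y : EuclideanSpace ℝ (Fin 3) => (G Y) 2) X := by
    intro X
    simp only [(hGper X).1, (hGper X).2.1, and_self]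
  have hperB : ∀ X : EuclideanSpace ℝ (Fin 3),
      (fun Y : EuclideanSpace ℝ (Fin 3) => (G Y) 2 * (‖G Y‖ ^ 2 / 2 + PG Y)) (X + EuclideanSpace.single 0 (1 : ℝ)) =
        (fun Y : EuclideanSpace ℝ (Fin 3) => (G Y) 2 * (‖G Y‖ ^ 2 / 2 + PG Y)) X ∧
      (fun Y : EuclideanSpace ℝ (Fin 3) => (G Y) 2 * (‖G Y‖ ^ 2 / 2 + PG Y)) (X + EuclideanSpace.single 1 (1 : ℝ)) =
        (fun Y : EuclideanSpace ℝ (Fin 3) => (G Y) 2 * (‖G Y‖ ^ 2 / 2 + PG Y)) X := by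
    intro X
    simp only [(hGper X).1, (hGper X).2.1, (hGper X).2.2.1, (hGper X).2.2.2, and_self]
  have hm : (∫ q in Set.Icc (0 : ℝ) 1 ×ˢ Set.Icc (0 : ℝ) 1, (G ((2 : ℝ) • !₂[q.1, q.2, (1 : ℝ)])) 2) = 0 := by
    have key := stub_halfScaleTrace (fun Y : EuclideanSpace ℝ (Fin 3) => (G Y) 2) h3 hper3
    simp only [] at key
    rw [key, hmass, hGm]
  have he : (∫ q in Set.Icc (0 : ℝ) 1 ×ˢ Set.Icc (0 : ℝ) 1,
      (G ((2 : ℝ) • !₂[q.1, q.2, (1 : ℝ)])) 2 *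
        (‖G ((2 : ℝ) • !₂[q.1, q.2, (1 : ℝ)])‖ ^ 2 / 2 + PG ((2 : ℝ) • !₂[q.1, q.2, (1 : ℝ)]))) = F := by
    have key := stub_halfScaleTrace (fun Y : EuclideanSpace ℝ (Fin 3) => (G Y) 2 * (‖G Y‖ ^ 2 / 2 + PG Y)) hB hperB
    simp only [] at key
    rw [key, henergy, hGe]
  exact Summit.AnomalousDissipation.AnomalousDissipation.Theorems.HalfSpaceHierarchy.stub_slabExtension
    (Summit.AnomalousDissipation.AnomalousDissipation.Theorems.HalfSpaceHierarchy.stub_slabOfBand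
      (stub_cellToBand G PG U P F η hG hPG hη hη' hU hP hUdiv hUE hUper htop hbot hm hF he))

end Summit.AnomalousDissipation.AnomalousDissipation.Cruxes.HalfSpaceHierarchy.BernoulliSurfaceTopology

end
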